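import Summits.ValiantsHypothesis.ValiantsHypothesis.Theorems.FreeSubtorusOrbitDimensionBoundStubDiagonalLiftsSchurian
import Literature.Computability.AlgebraicComplexity.BlockDecomposable
import Literature.Computability.AlgebraicComplexity.DetReprEquivalent

/-!
# `OrbitDimensionBound` (stmt-ValiantsHypothesis-16133), rung line `square_covering` — stub `stub_stableReduction`,
# part C₁: the matrix of a pencil restricted to an ATOM is block-indecomposable

Helper file for stub 1 `stub_stableReduction` of `Cruxes/OrbitDimensionBound/Lines/square_covering.lean` (route
`FreeSubtorus`).  In the language of part A (`…StubStableReductionLattice`): let `F e` be the coefficient maps of a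
square pencil on `ℂ^m`, `A ≤ ℂ^m` an ATOM (a minimal non-zero balanced subspace) of dimension `d`, and `M` a `d × d`
polynomial matrix which is the matrix of the restricted pencil `A → W(A)` in some bases — abstractly: there are
injective linear maps `φV, φW : ℂ^d → ℂ^m` with `φV(ℂ^d) ⊆ A` and `F e (φV c) = φW (M_e c)` for all `e, c`.  Then `M`
is NOT block-decomposable (`¬ IsBlockDecomposable M`, the tree notion): a block decomposition `P' M Q'` with corner `r`
would give the balanced subspace `φV (Q' ℂ^r) < A` of dimension `0 < r < d`, against minimality.  Also here: the conjugation
formula for exact lifts under a two-sided constant base change (`linSubstEntries_baseChange_of_lift`) and matrix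
equality from equality of all coefficient matrices (`eq_of_forall_map_coeff`).

Helper mode (`--supports stmt-ValiantsHypothesis-16133 --as helper`).  Honest framing: [folklore] linear algebra toward
ONE registered stub (`stub_stableReduction`, M) of a dormant rung line whose load-bearing stub `stub_gradedPowerCount` is
OPEN; the crux `OrbitDimensionBound`, the route `FreeSubtorus` and VP ≠ VNP are OPEN and are not moved by this file.

## References (orientation only)
* A. D. King, Quart. J. Math. 45 (1994), §3 (`θ`-stable = simple objects).
-/

set_option linter.dupNamespace false

namespace Summit.ValiantsHypothesis.ValiantsHypothesis.Theorems.FreeSubtorusOrbitDimensionBound.SquareCovering.StableReduction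

open Matrix MvPolynomial Module
open Literature.Computability.AlgebraicComplexity
open Summit.ValiantsHypothesis.ValiantsHypothesis.Theorems.FreeSubtorusOrbitDimensionBound.SignCovering.PerSummand

/-! ### §1 Small matrix facts -/

section Small

variable {σ : Type*} {ι κ : Type*}

/-- A polynomial matrix is determined by its coefficient matrices. [folklore] -/
theorem eq_of_forall_map_coeff {R : Type*} [CommSemiring R] (M N : Matrix ι κ (MvPolynomial σ R))
    (h : ∀ e : σ →₀ ℕ, M.map (coeff e) = N.map (coeff e)) : M = N := by
  ext i j e
  simpa only [Matrix.map_apply] using congrFun (congrFun (h e) i) j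

variable [Fintype σ] [DecidableEq σ] [Fintype ι] [DecidableEq ι]

/-- **Conjugating an exact lift by a constant base change**: if `M(γ·x) = g M h⁻¹` then
`(P M Q)(γ·x) = (P g P⁻¹) (P M Q) (Q⁻¹ h Q)⁻¹`. [folklore] -/
theorem linSubstEntries_baseChange_of_lift (γ : GL σ ℂ) (M : Matrix ι ι (MvPolynomial σ ℂ)) (g h P Q : GL ι ℂ)
    (hlift : Matrix.linSubstEntries γ M = (g : Matrix ι ι ℂ).map C * M * ((h⁻¹ : GL ι ℂ) : Matrix ι ι ℂ).map C) :
    Matrix.linSubstEntries γ ((P : Matrix ι ι ℂ).map C * M * (Q : Matrix ι ι ℂ).map C) =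
      ((P * g * P⁻¹ : GL ι ℂ) : Matrix ι ι ℂ).map C * ((P : Matrix ι ι ℂ).map C * M * (Q : Matrix ι ι ℂ).map C) *
        (((Q⁻¹ * h * Q)⁻¹ : GL ι ℂ) : Matrix ι ι ℂ).map C := by
  rw [Matrix.linSubstEntries_mul, Matrix.linSubstEntries_mul, Matrix.linSubstEntries_map_C,
    Matrix.linSubstEntries_map_C, hlift]
  simp only [_root_.mul_inv_rev, inv_inv, Units.val_mul, Matrix.map_mul, Matrix.mul_assoc,
    inv_map_C_mul_cancel_left, map_C_mul_inv_cancel_left]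

end Small

/-! ### §2 The embedding `ℂ^r ↪ ℂ^d` onto the first `r` coordinates and zero-corner matrices -/

section FirstCoords

variable {d r : ℕ}

/-- Matrices with zero corner (rows `≥ r`, columns `< r`) preserve the subspace of vectors supported on the first `r`
coordinates. [folklore] -/
theorem mulVec_apply_eq_zero_of_corner (X : Matrix (Fin d) (Fin d) ℂ)
    (hX : ∀ i j : Fin d, r ≤ (i : ℕ) → (j : ℕ) < r → X i j = 0) (u : Fin d → ℂ)
    (hu : ∀ a : Fin d, r ≤ (a : ℕ) → u a = 0) (a : Fin d) (ha : r ≤ (a : ℕ)) : (X *ᵥ u) a = 0 := by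
  rw [Matrix.mulVec, dotProduct]
  refine Finset.sum_eq_zero fun b _ => ?_
  by_cases hb : (b : ℕ) < r
  · rw [hX a b ha hb, zero_mul]
  · rw [hu b (not_lt.1 hb), mul_zero]

end FirstCoords

/-! ### §3 The block of an atom is block-indecomposable -/

section Atom

variable {σ : Type*} {m d : ℕ}

/-- **The matrix of a pencil restricted to an atom is block-indecomposable.**  Data: the coefficient maps
`F e = B_e` of a square pencil on `ℂ^m`; an atom `A` (non-zero, balanced, minimal — in the `V`-only language of
part A, `W(V) = ⨆ e, B_e V`) of dimension `d`; injective linear maps `φV, φW : ℂ^d → ℂ^m` with `φV (ℂ^d) ⊆ A`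
intertwining the `d × d` polynomial matrix `M` with the pencil (`F e ∘ φV = φW ∘ M_e`).  Then `¬ IsBlockDecomposable M`.
[folklore] -/
theorem not_isBlockDecomposable_of_atom (F : (σ →₀ ℕ) → (Fin m → ℂ) →ₗ[ℂ] (Fin m → ℂ))
    (A : Submodule ℂ (Fin m → ℂ)) (hAd : finrank ℂ A = d)
    (hAmin : ∀ A' : Submodule ℂ (Fin m → ℂ), A' ≤ A → A' ≠ ⊥ →
      finrank ℂ ↥(⨆ e, A'.map (F e)) ≤ finrank ℂ A' → A' = A)
    (M : Matrix (Fin d) (Fin d) (MvPolynomial σ ℂ))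
    (φV φW : (Fin d → ℂ) →ₗ[ℂ] (Fin m → ℂ)) (hφV : Function.Injective φV) (hφW : Function.Injective φW)
    (hφVA : ∀ c, φV c ∈ A) (hinter : ∀ (e : σ →₀ ℕ) (c : Fin d → ℂ), F e (φV c) = φW (M.map (coeff e) *ᵥ c)) :
    ¬ IsBlockDecomposable M := by
  classical
  rintro ⟨P', Q', r, hr0, hrd, hzero⟩
  -- the embedding of `ℂ^r` as the first `r` coordinates of `ℂ^d`
  let emb : (Fin r → ℂ) →ₗ[ℂ] (Fin d → ℂ) :=
    { toFun := fun c a => if h : (a : ℕ) < r then c ⟨a, h⟩ else 0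
      map_add' := fun c c' => by
        ext a; by_cases h : (a : ℕ) < r <;> simp [h]
      map_smul' := fun t c => by
        ext a; by_cases h : (a : ℕ) < r <;> simp [h] }
  have hemb_apply_lt : ∀ (c : Fin r → ℂ) (a : Fin d) (h : (a : ℕ) < r), emb c a = c ⟨a, h⟩ := fun c a h => by
    simp [emb, h]
  have hemb_apply_ge : ∀ (c : Fin r → ℂ) (a : Fin d), r ≤ (a : ℕ) → emb c a = 0 := fun c a h => by
    simp [emb, not_lt.2 h]
  have hemb_inj : Function.Injective emb := by
    intro c c' hcc'
    ext b
    have := congrFun hcc' (Fin.castLE hrd.le b)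
    rwa [hemb_apply_lt c _ (by simp), hemb_apply_lt c' _ (by simp)] at this
  -- a zero-corner matrix maps the image of `emb` into itself
  have hcorner_emb : ∀ X : Matrix (Fin d) (Fin d) ℂ, (∀ i j : Fin d, r ≤ (i : ℕ) → (j : ℕ) < r → X i j = 0) →
      ∀ c : Fin r → ℂ, ∃ c' : Fin r → ℂ, X *ᵥ emb c = emb c' := by
    intro X hX c
    refine ⟨fun b => (X *ᵥ emb c) (Fin.castLE hrd.le b), funext fun a => ?_⟩
    by_cases ha : (a : ℕ) < r
    · rw [hemb_apply_lt _ a ha]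
      rfl
    · rw [hemb_apply_ge _ a (not_lt.1 ha)]
      exact mulVec_apply_eq_zero_of_corner X hX (emb c) (fun b hb => hemb_apply_ge c b hb) a (not_lt.1 ha)
  let U : Submodule ℂ (Fin d → ℂ) := LinearMap.range emb
  have hUfin : finrank ℂ U = r := by
    rw [LinearMap.finrank_range_of_inj hemb_inj, Module.finrank_fin_fun]
  -- the sub-pencil `(V', W')`
  let V' : Submodule ℂ (Fin m → ℂ) := U.map (φV ∘ₗ Matrix.toLin' (Q' : Matrix (Fin d) (Fin d) ℂ))
  let W' : Submodule ℂ (Fin m → ℂ) := U.map (φW ∘ₗ Matrix.toLin' ((P'⁻¹ : GL (Fin d) ℂ) : Matrix (Fin d) (Fin d) ℂ))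
  have hinjV : Function.Injective (φV ∘ₗ Matrix.toLin' (Q' : Matrix (Fin d) (Fin d) ℂ)) := by
    refine hφV.comp ?_
    rw [← LinearMap.ker_eq_bot, Matrix.ker_toLin'_eq_bot_iff]
    intro v hv
    have := congrArg (fun w => ((Q'⁻¹ : GL (Fin d) ℂ) : Matrix (Fin d) (Fin d) ℂ) *ᵥ w) hv
    simpa only [Matrix.mulVec_mulVec, ← Units.val_mul, inv_mul_cancel, Units.val_one, Matrix.one_mulVec,
      Matrix.mulVec_zero] using this
  have hinjW : Function.Injective (φW ∘ₗ Matrix.toLin' ((P'⁻¹ : GL (Fin d) ℂ) : Matrix (Fin d) (Fin d) ℂ)) := by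
    refine hφW.comp ?_
    rw [← LinearMap.ker_eq_bot, Matrix.ker_toLin'_eq_bot_iff]
    intro v hv
    have := congrArg (fun w => ((P' : GL (Fin d) ℂ) : Matrix (Fin d) (Fin d) ℂ) *ᵥ w) hv
    simpa only [Matrix.mulVec_mulVec, ← Units.val_mul, mul_inv_cancel, Units.val_one, Matrix.one_mulVec,
      Matrix.mulVec_zero] using this
  have hV'fin : finrank ℂ V' = r := by
    rw [← hUfin]; exact LinearEquiv.finrank_eq (Submodule.equivMapOfInjective _ hinjV U).symm
  have hW'fin : finrank ℂ W' = r := by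
    rw [← hUfin]; exact LinearEquiv.finrank_eq (Submodule.equivMapOfInjective _ hinjW U).symm
  -- `B_e V' ⊆ W'`
  have hsub : ∀ e, V'.map (F e) ≤ W' := by
    intro e
    rintro y ⟨x, ⟨u, ⟨c, rfl⟩, rfl⟩, rfl⟩
    -- `x = φV (Q' (emb c))`, `y = F e x = φW (M_e Q' emb c) = φW (P'⁻¹ ((P' M_e Q') (emb c)))`
    have hPMQ : ∀ i j : Fin d, r ≤ (i : ℕ) → (j : ℕ) < r →
        ((P' : Matrix (Fin d) (Fin d) ℂ) * M.map (coeff e) * (Q' : Matrix (Fin d) (Fin d) ℂ)) i j = 0 := by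
      intro i j hi hj
      have h1 : (((P' : Matrix (Fin d) (Fin d) ℂ).map C * M * ((Q' : Matrix (Fin d) (Fin d) ℂ)).map C).map (coeff e) :
          Matrix (Fin d) (Fin d) ℂ) = (P' : Matrix (Fin d) (Fin d) ℂ) * M.map (coeff e) * (Q' : Matrix (Fin d) (Fin d) ℂ) := by
        rw [map_coeff_mul_map_C, map_coeff_map_C_mul]
      have h2 := congrFun (congrFun h1 i) j
      rw [Matrix.map_apply, hzero i j hi hj, coeff_zero] at h2
      exact h2.symm
    obtain ⟨c', hc'⟩ := hcorner_emb _ hPMQ c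
    refine ⟨emb c', ⟨c', rfl⟩, ?_⟩
    simp only [LinearMap.coe_comp, Function.comp_apply, Matrix.toLin'_apply]
    rw [hinter, Matrix.mulVec_mulVec]
    congr 1
    -- `M_e Q' emb c = P'⁻¹ (P' M_e Q' emb c) = P'⁻¹ emb c'`
    rw [← hc', Matrix.mulVec_mulVec, ← Matrix.mul_assoc, ← Matrix.mul_assoc, ← Units.val_mul, inv_mul_cancel,
      Units.val_one, Matrix.one_mul]
  -- `V'` is balanced, non-zero, proper, inside `A`: contradiction with minimality
  have hV'A : V' ≤ A := by
    rintro x ⟨u, -, rfl⟩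
    exact hφVA _
  have hV'0 : V' ≠ ⊥ := by
    intro h0
    rw [h0, finrank_bot] at hV'fin
    omega
  have hV'bal : finrank ℂ ↥(⨆ e, V'.map (F e)) ≤ finrank ℂ V' := by
    rw [hV'fin, ← hW'fin]
    exact Submodule.finrank_mono (iSup_le hsub)
  have hVA := hAmin V' hV'A hV'0 hV'bal
  have : r = d := by rw [← hV'fin, hVA, hAd]
  omega

end Atom

end Summit.ValiantsHypothesis.ValiantsHypothesis.Theorems.FreeSubtorusOrbitDimensionBound.SquareCovering.StableReduction
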